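import Summits.CriticalPhenomena.SAWScalingLimit.Theorems.SAWCompassLatticeSurfaceUniversalitySiteDictionary

/-!
# Stub `stub_siteApprox` (line `registered` v6) of the crux `SAWCompassLattice.SurfaceUniversality`
# (stmt-CriticalPhenomena-6964): a `ℤ²` endpoint approximation is a pinned endpoint approximation
# for the site rule

Route `SAWCompassLattice` (sub-problem `SAWScalingLimit`). A `ℤ²` endpoint approximation `(a, b)` of a
Dobrushin domain `D` (`SAW.IsEndpointApprox D a b`: eventually `a δ`, `b δ` are joined in `Ω_δ =
discreteDomainGraph D.carrier δ`, and `meshPoint δ (a δ) → D.pt 0`, `meshPoint δ (b δ) → D.pt 1` along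
`δ → 0⁺`) is a PINNED ENDPOINT APPROXIMATION for the site rule `siteRule`:

* eventually `a δ ≠ b δ` (the mesh points tend to the distinct marked points `D.pt 0 ≠ D.pt 1`), so the
  first edge of a joining walk shows `a δ ∈ meshDomain D.carrier δ`; bypassing the joining walk to a
  self-avoiding one and pushing it through the site dictionary (`plusOfWalk`, `isPath_plusOfWalk`,
  `support_plusOfWalk_subset`) joins `siteCentre (a δ)` to `siteCentre (b δ)` by a self-avoiding plus path
  inside `probeSupport siteRule D.carrier δ` (`plusJoinable`);
* the drawn centres `δ · embed (siteCentre x) = meshPoint δ x + δ/2` (`embed_siteCentre`) converge to the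
  marked points since `δ/2 → 0`.

Tagged [folklore] (bookkeeping).
-/

noncomputable section

namespace Summit.CriticalPhenomena.SAWScalingLimit.Theorems.SurfaceUniversality

open MeasureTheory Filter Topology Set Metric
open scoped NNReal ENNReal BoundedContinuousFunction
open Literature.Probability.RandomPlanarGeometry Literature.Probability.RandomPlanarGeometry.SAW
  Literature.Probability.RandomPlanarGeometry.SAW.YangBaxter Literature.Probability.LatticeModels

/-- Two sites joined in `Ω_δ`, the first one in `Ω_δ`, have centres joined by a self-avoiding plus path
through the site support (bypass the joining walk to a path and take its plus walk). [folklore] -/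
theorem siteCentre_mem_plusJoinable {Ω : Set ℂ} {δ : ℝ} {x y : Site 2} (hx : x ∈ meshDomain Ω δ)
    (h : (discreteDomainGraph Ω δ).Reachable x y) :
    (siteCentre x, siteCentre y) ∈ plusJoinable (probeSupport siteRule Ω δ) := by
  obtain ⟨p⟩ := h
  exact ⟨plusOfWalk p.bypass, isPath_plusOfWalk p.bypass_isPath, support_plusOfWalk_subset p.bypass hx⟩

/-- If the mesh points `meshPoint δ (x δ)` converge to `z` along `δ → 0⁺`, so do the drawn centres
`δ · embed (siteCentre (x δ)) = meshPoint δ (x δ) + δ/2`. [folklore] -/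
theorem tendsto_embed_siteCentre_of_tendsto {x : ℝ → Site 2} {z : ℂ}
    (h : Tendsto (fun δ => meshPoint δ (x δ)) (𝓝[>] (0 : ℝ)) (𝓝 z)) :
    Tendsto (fun δ : ℝ => (δ : ℂ) * PortGadget.embed plusPos (siteCentre (x δ))) (𝓝[>] (0 : ℝ))
      (𝓝 z) := by
  have hc : Tendsto (fun δ : ℝ => (δ : ℂ) / 2) (𝓝 (0 : ℝ)) (𝓝 (((0 : ℝ) : ℂ) / 2)) :=
    (Complex.continuous_ofReal.div_const (2 : ℂ)).tendsto (0 : ℝ)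
  rw [Complex.ofReal_zero, zero_div] at hc
  have h2 := h.add (tendsto_nhdsWithin_of_tendsto_nhds hc)
  rw [add_zero] at h2
  exact h2.congr fun δ => (embed_siteCentre δ (x δ)).symm

/-- Stub `stub_siteApprox` of the line `registered` (skeleton v6), crux `SAWCompassLattice.SurfaceUniversality`
(stmt-CriticalPhenomena-6964): **a `ℤ²` endpoint approximation is a pinned endpoint approximation for the
site rule** — eventually the centres `siteCentre (a δ)`, `siteCentre (b δ)` are joined by a self-avoiding plus
path inside `probeSupport siteRule D.carrier δ`, and their drawings converge to `D.pt 0`, `D.pt 1`. [folklore] -/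
theorem stub_siteApprox : ∀ (D : DobrushinDomain) (a b : ℝ → Site 2), SAW.IsEndpointApprox D a b → (∀ᶠ δ in 𝓝[>] (0 : ℝ), (siteCentre (a δ), siteCentre (b δ)) ∈ plusJoinable (probeSupport siteRule D.carrier δ)) ∧ Tendsto (fun δ : ℝ => (δ : ℂ) * PortGadget.embed plusPos (siteCentre (a δ))) (𝓝[>] (0 : ℝ)) (𝓝 (D.pt 0)) ∧ Tendsto (fun δ : ℝ => (δ : ℂ) * PortGadget.embed plusPos (siteCentre (b δ))) (𝓝[>] (0 : ℝ)) (𝓝 (D.pt 1)) := by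
  intro D a b hab
  refine ⟨?_, tendsto_embed_siteCentre_of_tendsto hab.tendsto_fst,
    tendsto_embed_siteCentre_of_tendsto hab.tendsto_snd⟩
  -- the two lattice endpoints are eventually distinct: their mesh points tend to `D.pt 0 ≠ D.pt 1`
  -- (adapted from the lead's skeleton `Cruxes/SurfaceUniversality/Lines/birth.lean`)
  have hpt : D.pt 0 ≠ D.pt 1 := fun h => absurd (D.pt_injective h) (by decide)
  obtain ⟨U, V, hU, hV, h0, h1, hUV⟩ := t2_separation hpt
  filter_upwards [hab.reachable, hab.tendsto_fst (hU.mem_nhds h0), hab.tendsto_snd (hV.mem_nhds h1)]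
    with δ hr hδ0 hδ1
  have hne : a δ ≠ b δ := fun heq => by
    have h0' : meshPoint δ (a δ) ∈ U := hδ0
    have h1' : meshPoint δ (b δ) ∈ V := hδ1
    rw [heq] at h0'
    exact Set.disjoint_left.1 hUV h0' h1'
  -- so a joining walk is not nil and its first edge is an edge of `Ω_δ`: `a δ ∈ meshDomain D.carrier δ`
  obtain ⟨p⟩ := hr
  exact siteCentre_mem_plusJoinable
    (discreteDomainGraph_adj_iff.1 (p.adj_snd (SimpleGraph.Walk.not_nil_of_ne hne))).2.1 ⟨p⟩

end Summit.CriticalPhenomena.SAWScalingLimit.Theorems.SurfaceUniversality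

end
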